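import Mathlib
import Literature.NumberTheory.Automorphic.HilbertModularFormQExpansion
import Summits.Langlands.Langlands.Theorems.CapacityClassicalityHilbertIntegralOverconvergentIsCongruenceStubSlashMul
import Summits.Langlands.Langlands.Theorems.CapacityClassicalityHilbertIntegralOverconvergentIsCongruenceStubTransferFunctions

/-!
# Weight-`k` transformation laws pass to the generated subgroup (stub `stub_transform_of_closure` of line Sketch-ideate-r1-k1)

Stub V7 `stub_transform_of_closure` of line Sketch-ideate-r1-k1 (section V) for the crux
`HilbertIntegralOverconvergentIsCongruence` (stmt-Langlands-8485): if a function `f` on `ℂ^{Hom(F,ℝ)}`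
satisfies the weight-`k` law `f(γ z) = J_k(γ, z) f(z)` for all `z ∈ ℍ` and all `γ` in a set
`G ⊆ SL₂(𝓞 F)`, then it satisfies it for every `γ` in the subgroup generated by `G`.  This is the
abstract group-theoretic step used to check modularity on generators (translations and lower
unipotents).  Proof: `Subgroup.closure_induction` with the predicate
`p γ := ∀ z ∈ ℍ, f (γ z) = J_k(γ, z) f z`; the identity by `moeb 1 z = z`, `J_k(1, z) = 1`
(`trf_moeb_one`, `trf_autFactor_one`); products by the action law `(γ δ) z = γ (δ z)` and the cocycle
law `J_k(γ δ, z) = J_k(γ, δ z) J_k(δ, z)` on `ℍ` (`slm_moeb_mul`, `slm_autFactor_mul`,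
`slm_moeb_mem_halfSpace`); inverses by applying the law for `γ` at `w = γ⁻¹ z ∈ ℍ`, where
`γ w = z` and `J_k(γ, w) J_k(γ⁻¹, z) = J_k(1, z) = 1`, and dividing by `J_k(γ, w) ≠ 0`
(`autFactor_ne_zero`).
-/

set_option linter.dupNamespace false

noncomputable section

namespace Summit.Langlands.Langlands.Theorems.HilbertIntegralOverconvergentIsCongruence

open MeasureTheory Complex NumberField
open Literature.NumberTheory.Automorphic Literature.NumberTheory.Automorphic.HilbertModular
open scoped MatrixGroups

variable {F : Type} [Field F] [NumberField F]

/-- The weight-`k` law holds for the identity: `f (1 z) = J_k(1, z) f z`, as `1 z = z` and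
`J_k(1, z) = 1`. [folklore] -/
theorem toc_law_one (k : (F →+* ℝ) → ℤ) (f : Point F → ℂ) :
    ∀ z ∈ halfSpace F, f (moeb (toSL2F (1 : SL(2, 𝓞 F))) z) =
      autFactor k (toSL2F (1 : SL(2, 𝓞 F))) z * f z := by
  intro z _
  rw [map_one, trf_moeb_one, trf_autFactor_one, one_mul]

/-- The weight-`k` law is stable under products: if it holds for `γ` and for `δ` on `ℍ`, it holds for
`γ δ`, by the action law `(γ δ) z = γ (δ z)` and the cocycle law
`J_k(γ δ, z) = J_k(γ, δ z) J_k(δ, z)` on `ℍ` (and `δ z ∈ ℍ`). [folklore] -/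
theorem toc_law_mul (k : (F →+* ℝ) → ℤ) (f : Point F → ℂ) {γ δ : SL(2, 𝓞 F)}
    (hγ : ∀ z ∈ halfSpace F, f (moeb (toSL2F γ) z) = autFactor k (toSL2F γ) z * f z)
    (hδ : ∀ z ∈ halfSpace F, f (moeb (toSL2F δ) z) = autFactor k (toSL2F δ) z * f z) :
    ∀ z ∈ halfSpace F, f (moeb (toSL2F (γ * δ)) z) = autFactor k (toSL2F (γ * δ)) z * f z := by
  intro z hz
  have hw : moeb (toSL2F δ) z ∈ halfSpace F := slm_moeb_mem_halfSpace _ hz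
  rw [map_mul, slm_moeb_mul _ _ hz, slm_autFactor_mul k _ _ hz, hγ _ hw, hδ z hz, mul_assoc]

/-- The weight-`k` law is stable under inverses: if it holds for `γ` on `ℍ`, it holds for `γ⁻¹`.
For `z ∈ ℍ` put `w = γ⁻¹ z ∈ ℍ`; then `γ w = z`, the law for `γ` at `w` reads `f z = J_k(γ, w) f w`,
and the cocycle law gives `J_k(γ, w) J_k(γ⁻¹, z) = J_k(1, z) = 1`, so `J_k(γ⁻¹, z) = J_k(γ, w)⁻¹`
and `f w = J_k(γ⁻¹, z) f z` (`J_k(γ, w) ≠ 0` on `ℍ`). [folklore] -/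
theorem toc_law_inv (k : (F →+* ℝ) → ℤ) (f : Point F → ℂ) {γ : SL(2, 𝓞 F)}
    (hγ : ∀ z ∈ halfSpace F, f (moeb (toSL2F γ) z) = autFactor k (toSL2F γ) z * f z) :
    ∀ z ∈ halfSpace F, f (moeb (toSL2F γ⁻¹) z) = autFactor k (toSL2F γ⁻¹) z * f z := by
  intro z hz
  have hw : moeb (toSL2F γ⁻¹) z ∈ halfSpace F := slm_moeb_mem_halfSpace _ hz
  have hback : moeb (toSL2F γ) (moeb (toSL2F γ⁻¹) z) = z := by
    rw [← slm_moeb_mul _ _ hz, ← map_mul, mul_inv_cancel, map_one, trf_moeb_one]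
  have hcoc : autFactor k (toSL2F γ) (moeb (toSL2F γ⁻¹) z) * autFactor k (toSL2F γ⁻¹) z = 1 := by
    rw [← slm_autFactor_mul k _ _ hz, ← map_mul, mul_inv_cancel, map_one, trf_autFactor_one]
  have h := hγ _ hw
  rw [hback] at h
  have hne : autFactor k (toSL2F γ) (moeb (toSL2F γ⁻¹) z) ≠ 0 := autFactor_ne_zero k _ hw
  rw [eq_inv_of_mul_eq_one_right hcoc, h, ← mul_assoc, inv_mul_cancel₀ hne, one_mul]

/-- **stub V7 — `stub_transform_of_closure` (M; transformation laws pass to the generated subgroup).** If `f` satisfies the weight-`k`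
law `f(γz) = J_k(γ,z) f(z)` on `ℍ` for every `γ` in a set `G ⊆ SL₂(𝓞F)`, it satisfies it for every `γ` in the subgroup generated by `G`
(`Subgroup.closure_induction`: the Möbius action is an action and `J_k` a cocycle — landed `stub_slash_mul` —, `γ = 1` by `trf_moeb_one`
/ `trf_autFactor_one`, inverses by applying the law at `γ⁻¹z`). [folklore] -/
theorem stub_transform_of_closure (F : Type) [Field F] [NumberField F] (k : (F →+* ℝ) → ℤ) (f : Point F → ℂ)
    (G : Set SL(2, 𝓞 F))
    (hG : ∀ γ ∈ G, ∀ z ∈ halfSpace F, f (moeb (toSL2F γ) z) = autFactor k (toSL2F γ) z * f z) :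
    ∀ γ ∈ Subgroup.closure G, ∀ z ∈ halfSpace F, f (moeb (toSL2F γ) z) = autFactor k (toSL2F γ) z * f z := by
  intro γ hγ
  induction hγ using Subgroup.closure_induction with
  | mem x hx => exact hG x hx
  | one => exact toc_law_one k f
  | mul x y _ _ ihx ihy => exact toc_law_mul k f ihx ihy
  | inv x _ ih => exact toc_law_inv k f ih

end Summit.Langlands.Langlands.Theorems.HilbertIntegralOverconvergentIsCongruence
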